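import Summits.CriticalPhenomena.PercolationContinuityZ3.Theorems.FK.InfiniteVolumeFiniteEnergy
import Summits.CriticalPhenomena.PercolationContinuityZ3.Theorems.FK.InfiniteVolumeFKG
import HarnessLib

/-!
# FK-continuity cell, FO-10a: local limit points of box measures with arbitrary one-class boundary wirings are
# POSITIVELY ASSOCIATED and have FINITE ENERGY (Grimmett 2006, Thm. (4.17)(b),(c) for the boundary conditions of the tree)

Registered R105 (cell INBOX l.7099, 2026-08-24); registry row FO-10a-g340e; label BCL-A (coordinator fk-4 g217).
Cell `fk-continuity` (bschramm), row FO-10a (domain-Markov + boundary-condition comparison layer over FO-06); support file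
for the FK-continuity transplant (`--supports stmt-CriticalPhenomena-4575`); builds on p205010 (kernel theorem, internal
audit signed; external expert review pending). Pure proofs; no definitions, no named facts, no sorries; general `d`.
UNCONDITIONAL infinite-volume structure; it decides nothing about FH / TP_FK / the value of `p_c(q)`.

Grimmett 2006, Thm. (4.17): every limit random-cluster measure `φ ∈ W_{p,q}` (b) has the finite-energy property and (c)
is positively associated when `q ≥ 1`. FO-06b proved both for the two extreme box limits `φ^b_{p,q}`
(`InfiniteVolumeFiniteEnergy`, `InfiniteVolumeFKG`). Here the same for EVERY local limit point `P` of box measures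
`φ^{B_k}_{Λ_{N_k},p,q}` with ARBITRARY wired classes `B_k` of the box `Λ_{N_k}` (any `N_k`; `0 ≤ p ≤ 1`, `q ≥ 1`;
`φ^B_Λ(A)` read as `(rcMeasure (finsetGraph (zdGraph d) Λ) p q B).real (liftEdges Λ ⁻¹' A)`):

* `rcMeasure_pow_mul_real_preimage_openEdges_liftEdges_le` / `rcMeasure_pow_mul_real_preimage_sdiff_liftEdges_le` — the
  finite-volume insertion / deletion tolerance (3.4) for an arbitrary wired class `B`, read on `ℤ^d`
  (FO-06b stated it for `rcBoxLaw d b`);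
* **`isPositivelyAssociated_of_tendsto_wiring`** — Thm. (4.17)(c): `P(A ∩ A') ≥ P(A) P(A')` for ALL measurable increasing
  events (finite-volume FKG, Thm. (3.8), for every wired class, passed to the local limit by FO-06b's
  `isPositivelyAssociated_of_tendsto_isLocalEvent`, Prop. (4.10)(b)); `real_mul_le_inter_of_tendsto_wiring`;
* **`pow_mul_real_preimage_openEdges_le_of_tendsto_wiring`**, **`pow_mul_real_preimage_sdiff_le_of_tendsto_wiring`** —
  Thm. (4.17)(b) integrated: `(p/(p+q(1-p)))^{|F|} · P{ω | ω ∪ F ∈ A} ≤ P(A)` (`F ⊆ E(ℤ^d)` finite) and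
  `(1-p)^{|F|} · P{ω | ω ∖ F ∈ A} ≤ P(A)` for EVERY measurable `A` (local events by the limit, all events by FO-06b's
  `mul_real_preimage_le_of_isLocalEvent`); box forms `insertion_tolerant_of_tendsto_wiring` /
  `isDeletionTolerant_of_tendsto_wiring`.

No hypothesis `B_k ⊆ ∂Λ_{N_k}` is needed here (both properties hold for every wired class and pass to any local limit);
`N_k → ∞` enters only the insertion half (the inserted edges must lie in the box). Honest framing: infinite-volume
bookkeeping; no statement about `p_c(q)`; NOT a binder discharge, NOT `_r4`.
Companions: `BoundaryWiringLimitPoints.lean` (existence of limit points, `FKGibbs`), `BoundaryWiringSandwich.lean`.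

## References

* G. Grimmett, *The Random-Cluster Model*, Springer 2006 (`book:grimmett2006-random-cluster-model`): Thm. (3.1) eq. (3.4),
  Thm. (3.8), Prop. (4.10)(b), Thm. (4.17)(b),(c) [PDF pp. 44–47, 72, 75–76]. [Grimmett2006]
-/

noncomputable section

open MeasureTheory Set Filter Finset
open scoped Topology ENNReal

namespace Summit.CriticalPhenomena.PercolationContinuityZ3.Theorems.FK

open Literature.Probability.Percolation Literature.Probability.LatticeModels

variable {d : ℕ} {p q : ℝ}

/-! ### Finite volume: finite energy for an arbitrary wired class, read on `ℤ^d` -/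

/-- **Insertion tolerance of `φ^B_{Λ_n,p,q}`** for an arbitrary wired class `B`: for a finite set `F ⊆ E(ℤ^d)` of edges
inside `Λ_n` and every event `A`, `(p/(p+q(1-p)))^{|F|} · φ^B_{Λ_n}{ω | ω ∪ F ∈ A} ≤ φ^B_{Λ_n}(A)` (`0 ≤ p ≤ 1`,
`q ≥ 1`). [cite: Grimmett2006, Thm. (3.1), eq. (3.4)] -/
theorem rcMeasure_pow_mul_real_preimage_openEdges_liftEdges_le (hp : p ∈ Set.Icc (0 : ℝ) 1) (hq : 1 ≤ q) {n : ℕ}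
    (B : Set ↥(box d n)) {F : Finset (Sym2 (Site d))} (hFE : (↑F : Set (Sym2 (Site d))) ⊆ (zdGraph d).edgeSet)
    (hF : ∀ e ∈ F, ∀ z ∈ e, z ∈ box d n) (A : Set (BondConfig (Site d))) :
    (p / (p + q * (1 - p))) ^ F.card *
        (rcMeasure (finsetGraph (zdGraph d) (box d n)) p q B).real (liftEdges (box d n) ⁻¹' (openEdges ↑F ⁻¹' A)) ≤
      (rcMeasure (finsetGraph (zdGraph d) (box d n)) p q B).real (liftEdges (box d n) ⁻¹' A) := by
  obtain ⟨F', hF', hcard⟩ := exists_finset_preimage_map_val n F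
  have hpre : liftEdges (box d n) ⁻¹' (openEdges ↑F ⁻¹' A) =
      openEdges ↑F' ⁻¹' (liftEdges (box d n) ⁻¹' A) := by
    ext ω
    simp only [Set.mem_preimage, openEdges, hF', liftEdges_union_preimage hF]
  rw [hpre]
  have hc0 : 0 ≤ p / (p + q * (1 - p)) := div_nonneg hp.1 (insertionDenominator_pos hp hq).le
  have hc1 : p / (p + q * (1 - p)) ≤ 1 := by
    rw [div_le_one (insertionDenominator_pos hp hq)]
    nlinarith [hp.2, hq]
  calc (p / (p + q * (1 - p))) ^ F.card *
        (rcMeasure (finsetGraph (zdGraph d) (box d n)) p q B).real (openEdges ↑F' ⁻¹' (liftEdges (box d n) ⁻¹' A))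
      ≤ (p / (p + q * (1 - p))) ^ F'.card *
        (rcMeasure (finsetGraph (zdGraph d) (box d n)) p q B).real (openEdges ↑F' ⁻¹' (liftEdges (box d n) ⁻¹' A)) :=
        mul_le_mul_of_nonneg_right (pow_le_pow_of_le_one hc0 hc1 hcard) measureReal_nonneg
    _ ≤ (rcMeasure (finsetGraph (zdGraph d) (box d n)) p q B).real (liftEdges (box d n) ⁻¹' A) :=
        rcMeasure_pow_mul_real_preimage_openEdges_le _ hp hq _ (preimage_map_val_subset_edgeFinset hFE F' hF') _

/-- **Deletion tolerance of `φ^B_{Λ_n,p,q}`** for an arbitrary wired class `B`: for a finite set `F` of pairs and every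
event `A`, `(1-p)^{|F|} · φ^B_{Λ_n}{ω | ω ∖ F ∈ A} ≤ φ^B_{Λ_n}(A)`. [cite: Grimmett2006, Thm. (3.1), eq. (3.4)] -/
theorem rcMeasure_pow_mul_real_preimage_sdiff_liftEdges_le (hp : p ∈ Set.Icc (0 : ℝ) 1) (hq : 1 ≤ q) {n : ℕ}
    (B : Set ↥(box d n)) (F : Finset (Sym2 (Site d))) (A : Set (BondConfig (Site d))) :
    (1 - p) ^ F.card *
        (rcMeasure (finsetGraph (zdGraph d) (box d n)) p q B).real
          (liftEdges (box d n) ⁻¹' ((fun ω : BondConfig (Site d) => ω \ ↑F) ⁻¹' A)) ≤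
      (rcMeasure (finsetGraph (zdGraph d) (box d n)) p q B).real (liftEdges (box d n) ⁻¹' A) := by
  obtain ⟨F', hF', hcard⟩ := exists_finset_preimage_map_val n F
  have hpre : liftEdges (box d n) ⁻¹' ((fun ω : BondConfig (Site d) => ω \ ↑F) ⁻¹' A) =
      (fun ω : BondConfig ↥(box d n) => ω \ ↑F') ⁻¹' (liftEdges (box d n) ⁻¹' A) := by
    ext ω
    simp only [Set.mem_preimage, hF', liftEdges_diff_preimage F]
  rw [hpre]
  have hc0 : 0 ≤ 1 - p := sub_nonneg.2 hp.2
  have hc1 : 1 - p ≤ 1 := sub_le_self 1 hp.1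
  calc (1 - p) ^ F.card *
        (rcMeasure (finsetGraph (zdGraph d) (box d n)) p q B).real
          ((fun ω : BondConfig ↥(box d n) => ω \ ↑F') ⁻¹' (liftEdges (box d n) ⁻¹' A))
      ≤ (1 - p) ^ F'.card *
        (rcMeasure (finsetGraph (zdGraph d) (box d n)) p q B).real
          ((fun ω : BondConfig ↥(box d n) => ω \ ↑F') ⁻¹' (liftEdges (box d n) ⁻¹' A)) :=
        mul_le_mul_of_nonneg_right (pow_le_pow_of_le_one hc0 hc1 hcard) measureReal_nonneg
    _ ≤ (rcMeasure (finsetGraph (zdGraph d) (box d n)) p q B).real (liftEdges (box d n) ⁻¹' A) :=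
        rcMeasure_pow_mul_real_preimage_sdiff_le _ hp hq _ F' _

/-! ### Local limit points: positive association (Thm. (4.17)(c)) and finite energy (Thm. (4.17)(b)) -/

section LimitPoint

variable {Ns : ℕ → ℕ} {B : ∀ k : ℕ, Set ↥(box d (Ns k))} {P : Measure (BondConfig (Site d))}

/-- **Grimmett 2006, Thm. (4.17)(c) for the boundary conditions of the tree**: a local limit point `P` of box measures
with arbitrary wired classes is POSITIVELY ASSOCIATED — `P(A) P(A') ≤ P(A ∩ A')` for all measurable increasing `A, A'`
(`0 ≤ p ≤ 1`, `q ≥ 1`). [cite: Grimmett2006, Thm. (4.17)(c) with Thm. (3.8) and Prop. (4.10)(b)] -/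
theorem isPositivelyAssociated_of_tendsto_wiring [IsProbabilityMeasure P] (hp : p ∈ Set.Icc (0 : ℝ) 1) (hq : 1 ≤ q)
    (hP : ∀ A : Set (BondConfig (Site d)), IsLocalEvent A →
      Tendsto (fun k => (rcMeasure (finsetGraph (zdGraph d) (box d (Ns k))) p q (B k)).real
        (liftEdges (box d (Ns k)) ⁻¹' A)) atTop (𝓝 (P.real A))) :
    IsPositivelyAssociated P := by
  set ν : ℕ → Measure (BondConfig (Site d)) :=
    fun k => (rcMeasure (finsetGraph (zdGraph d) (box d (Ns k))) p q (B k)).map (liftEdges (box d (Ns k))) with hν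
  have hνprob : ∀ k, IsProbabilityMeasure (ν k) := fun k => by
    haveI := isProbabilityMeasure_rcMeasure (finsetGraph (zdGraph d) (box d (Ns k))) hp (one_pos.trans_le hq) (B k)
    exact Measure.isProbabilityMeasure_map (measurable_liftEdges (box d (Ns k))).aemeasurable
  refine isPositivelyAssociated_of_tendsto_isLocalEvent ν P
    (fun k => (isPositivelyAssociated_rcMeasure _ hp hq (B k)).map (liftEdges_mono (box d (Ns k)))
      (measurable_liftEdges (box d (Ns k)))) fun A hA => ?_
  have hAm := measurableSet_of_isLocalEvent_holds hA
  haveI := hνprob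
  have hνreal : ∀ k, ((ν k) A).toReal =
      (rcMeasure (finsetGraph (zdGraph d) (box d (Ns k))) p q (B k)).real (liftEdges (box d (Ns k)) ⁻¹' A) :=
    fun k => by rw [← measureReal_def, hν, map_measureReal_apply (measurable_liftEdges (box d (Ns k))) hAm]
  refine (ENNReal.tendsto_toReal_iff (fun k => measure_ne_top (ν k) A) (measure_ne_top P A)).1 ?_
  rw [← measureReal_def]
  exact (hP A hA).congr fun k => (hνreal k).symm

/-- Real-valued form, two increasing measurable events: `P(A) P(A') ≤ P(A ∩ A')`.
[cite: Grimmett2006, Thm. (4.17)(c)] -/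
theorem real_mul_le_inter_of_tendsto_wiring [IsProbabilityMeasure P] (hp : p ∈ Set.Icc (0 : ℝ) 1) (hq : 1 ≤ q)
    (hP : ∀ A : Set (BondConfig (Site d)), IsLocalEvent A →
      Tendsto (fun k => (rcMeasure (finsetGraph (zdGraph d) (box d (Ns k))) p q (B k)).real
        (liftEdges (box d (Ns k)) ⁻¹' A)) atTop (𝓝 (P.real A)))
    {A A' : Set (BondConfig (Site d))} (hA : IsUpperSet A) (hAm : MeasurableSet A) (hA' : IsUpperSet A')
    (hA'm : MeasurableSet A') : P.real A * P.real A' ≤ P.real (A ∩ A') :=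
  (isPositivelyAssociated_of_tendsto_wiring hp hq hP).real hA hA' hAm hA'm

/-- **Insertion tolerance of a limit point on local events.** [cite: Grimmett2006, Thm. (4.17)(b) with Thm. (3.1), eq. (3.4)] -/
theorem pow_mul_real_preimage_openEdges_le_of_tendsto_wiring_of_isLocalEvent (hp : p ∈ Set.Icc (0 : ℝ) 1)
    (hq : 1 ≤ q) (hNs : Tendsto Ns atTop atTop)
    (hP : ∀ A : Set (BondConfig (Site d)), IsLocalEvent A →
      Tendsto (fun k => (rcMeasure (finsetGraph (zdGraph d) (box d (Ns k))) p q (B k)).real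
        (liftEdges (box d (Ns k)) ⁻¹' A)) atTop (𝓝 (P.real A)))
    {F : Finset (Sym2 (Site d))} (hFE : (↑F : Set (Sym2 (Site d))) ⊆ (zdGraph d).edgeSet)
    {A : Set (BondConfig (Site d))} (hA : IsLocalEvent A) :
    (p / (p + q * (1 - p))) ^ F.card * P.real (openEdges ↑F ⁻¹' A) ≤ P.real A := by
  have h1 := (hP _ (hA.preimage_openEdges ↑F)).const_mul ((p / (p + q * (1 - p))) ^ F.card)
  refine le_of_tendsto_of_tendsto h1 (hP A hA) ?_
  filter_upwards [hNs.eventually (eventually_ge_atTop (F.sup pairRad))] with k hk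
  exact rcMeasure_pow_mul_real_preimage_openEdges_liftEdges_le hp hq (B k) hFE
    (forall_mem_box_of_sup_pairRad_le hk) A

/-- **Deletion tolerance of a limit point on local events.** [cite: Grimmett2006, Thm. (4.17)(b) with Thm. (3.1), eq. (3.4)] -/
theorem pow_mul_real_preimage_sdiff_le_of_tendsto_wiring_of_isLocalEvent (hp : p ∈ Set.Icc (0 : ℝ) 1) (hq : 1 ≤ q)
    (hP : ∀ A : Set (BondConfig (Site d)), IsLocalEvent A →
      Tendsto (fun k => (rcMeasure (finsetGraph (zdGraph d) (box d (Ns k))) p q (B k)).real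
        (liftEdges (box d (Ns k)) ⁻¹' A)) atTop (𝓝 (P.real A)))
    (F : Finset (Sym2 (Site d))) {A : Set (BondConfig (Site d))} (hA : IsLocalEvent A) :
    (1 - p) ^ F.card * P.real ((fun ω => ω \ ↑F) ⁻¹' A) ≤ P.real A := by
  have h1 := (hP _ (isLocalEvent_preimage_sdiff hA ↑F)).const_mul ((1 - p) ^ F.card)
  exact le_of_tendsto_of_tendsto' h1 (hP A hA) fun k =>
    rcMeasure_pow_mul_real_preimage_sdiff_liftEdges_le hp hq (B k) F A

/-- **Grimmett 2006, Thm. (4.17)(b), insertion half, for every measurable event**: for a local limit point `P` of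
arbitrarily wired box measures (`N_k → ∞`), a finite set `F ⊆ E(ℤ^d)` and every measurable `A`,
`(p/(p+q(1-p)))^{|F|} · P{ω | ω ∪ F ∈ A} ≤ P(A)`. [cite: Grimmett2006, Thm. (4.17)(b) with Thm. (3.1), eq. (3.4)] -/
theorem pow_mul_real_preimage_openEdges_le_of_tendsto_wiring [IsProbabilityMeasure P] (hp : p ∈ Set.Icc (0 : ℝ) 1)
    (hq : 1 ≤ q) (hNs : Tendsto Ns atTop atTop)
    (hP : ∀ A : Set (BondConfig (Site d)), IsLocalEvent A →
      Tendsto (fun k => (rcMeasure (finsetGraph (zdGraph d) (box d (Ns k))) p q (B k)).real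
        (liftEdges (box d (Ns k)) ⁻¹' A)) atTop (𝓝 (P.real A)))
    {F : Finset (Sym2 (Site d))} (hFE : (↑F : Set (Sym2 (Site d))) ⊆ (zdGraph d).edgeSet)
    {A : Set (BondConfig (Site d))} (hA : MeasurableSet A) :
    (p / (p + q * (1 - p))) ^ F.card * P.real (openEdges ↑F ⁻¹' A) ≤ P.real A :=
  mul_real_preimage_le_of_isLocalEvent (measurable_openEdges _)
    (pow_nonneg (div_nonneg hp.1 (insertionDenominator_pos hp hq).le) _)
    (fun _ hA' => pow_mul_real_preimage_openEdges_le_of_tendsto_wiring_of_isLocalEvent hp hq hNs hP hFE hA') hA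

/-- **Grimmett 2006, Thm. (4.17)(b), deletion half, for every measurable event**: `(1-p)^{|F|} · P{ω | ω ∖ F ∈ A} ≤ P(A)`.
[cite: Grimmett2006, Thm. (4.17)(b) with Thm. (3.1), eq. (3.4)] -/
theorem pow_mul_real_preimage_sdiff_le_of_tendsto_wiring [IsProbabilityMeasure P] (hp : p ∈ Set.Icc (0 : ℝ) 1)
    (hq : 1 ≤ q)
    (hP : ∀ A : Set (BondConfig (Site d)), IsLocalEvent A →
      Tendsto (fun k => (rcMeasure (finsetGraph (zdGraph d) (box d (Ns k))) p q (B k)).real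
        (liftEdges (box d (Ns k)) ⁻¹' A)) atTop (𝓝 (P.real A)))
    (F : Finset (Sym2 (Site d))) {A : Set (BondConfig (Site d))} (hA : MeasurableSet A) :
    (1 - p) ^ F.card * P.real ((fun ω => ω \ ↑F) ⁻¹' A) ≤ P.real A :=
  mul_real_preimage_le_of_isLocalEvent (measurable_closeEdges _) (pow_nonneg (sub_nonneg.2 hp.2) _)
    (fun _ hA' => pow_mul_real_preimage_sdiff_le_of_tendsto_wiring_of_isLocalEvent hp hq hP F hA') hA

/-- **Box form of insertion tolerance** (the `insertion_tolerant` field of the tree's `IsInsertionTolerantErgodic`):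
for `0 < p ≤ 1`, `q ≥ 1` and every box `Λ_N` there is `c > 0` with `c · P{ω | ω ∪ E(Λ_N) ∈ S} ≤ P(S)` for all measurable `S`.
[cite: Grimmett2006, Thm. (4.17)(b) with eq. (3.4)] -/
theorem insertion_tolerant_of_tendsto_wiring [IsProbabilityMeasure P] (hp : p ∈ Set.Ioc (0 : ℝ) 1) (hq : 1 ≤ q)
    (hNs : Tendsto Ns atTop atTop)
    (hP : ∀ A : Set (BondConfig (Site d)), IsLocalEvent A →
      Tendsto (fun k => (rcMeasure (finsetGraph (zdGraph d) (box d (Ns k))) p q (B k)).real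
        (liftEdges (box d (Ns k)) ⁻¹' A)) atTop (𝓝 (P.real A))) (N : ℕ) :
    ∃ c : ℝ, 0 < c ∧ ∀ {S : Set (BondConfig (Site d))}, MeasurableSet S →
      c * P.real (openEdges ↑(edgesIn (zdGraph d) (box d N)) ⁻¹' S) ≤ P.real S := by
  have hp' : p ∈ Set.Icc (0 : ℝ) 1 := ⟨hp.1.le, hp.2⟩
  refine ⟨(p / (p + q * (1 - p))) ^ (edgesIn (zdGraph d) (box d N)).card,
    pow_pos (div_pos hp.1 (insertionDenominator_pos hp' hq)) _, fun hS => ?_⟩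
  exact pow_mul_real_preimage_openEdges_le_of_tendsto_wiring hp' hq hNs hP
    (fun _ he => (mem_edgesIn_iff.1 (Finset.mem_coe.1 he)).1) hS

/-- **Box form of deletion tolerance**: for `0 ≤ p < 1`, `q ≥ 1`, a local limit point of arbitrarily wired box measures is
deletion tolerant in the sense of the tree's `IsDeletionTolerant`. [cite: Grimmett2006, Thm. (4.17)(b) with eq. (3.4)] -/
theorem isDeletionTolerant_of_tendsto_wiring [IsProbabilityMeasure P] (hp : p ∈ Set.Ico (0 : ℝ) 1) (hq : 1 ≤ q)
    (hP : ∀ A : Set (BondConfig (Site d)), IsLocalEvent A →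
      Tendsto (fun k => (rcMeasure (finsetGraph (zdGraph d) (box d (Ns k))) p q (B k)).real
        (liftEdges (box d (Ns k)) ⁻¹' A)) atTop (𝓝 (P.real A))) :
    IsDeletionTolerant P := by
  have hp' : p ∈ Set.Icc (0 : ℝ) 1 := ⟨hp.1, hp.2.le⟩
  intro N
  refine ⟨(1 - p) ^ (edgesIn (zdGraph d) (box d N)).card, pow_pos (sub_pos.2 hp.2) _, fun S hS => ?_⟩
  exact pow_mul_real_preimage_sdiff_le_of_tendsto_wiring hp' hq hP _ hS

end LimitPoint

end Summit.CriticalPhenomena.PercolationContinuityZ3.Theorems.FK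

end
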